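import Summits.AnomalousDissipation.AnomalousDissipation.Theses.TaylorCertificates
import Literature.Analysis.FluidPDE.TimeAverageMeasureExistence
import Literature.Analysis.FluidPDE.StatisticalSolutionsProofs
import HarnessLib

/-!
# Route TaylorCertificates — the support `EnsembleCeilingTransfer`

Proof of the route declaration
`Summit.AnomalousDissipation.AnomalousDissipation.Theses.TaylorCertificates.EnsembleCeilingTransfer`
(item stmt-AnomalousDissipation-14092): the ENSEMBLE-TO-PATH transfer of an energy ceiling. For
`ν > 0` and a smooth force `f` on `T³`, if every stationary statistical solution `μ` of NS_ν(f)
(FMRT 2001, Ch. IV Def. 1.3) with integrable energy has `∫ |v|² dμ ≤ E`, then every global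
Leray–Hopf solution `u` whose `H`-lift `U` stays in a ball `|U t|² ≤ ρ` (`t ≥ 0`) has
`meanEnergy u = limsup_T T⁻¹ ∫₀ᵀ |u(t)|² dt ≤ E`.

Proof (Foias–Manley–Rosa–Temam 2001, Ch. IV §1.3 and §3.1):

* a generalized (Banach) limit `Λ` with `Λ h = limsup h` for the ONE eventually bounded function
  `h = (T ↦ T⁻¹ ∫₀ᵀ |U t|² dt)` (`exists_generalizedLimit_apply_eq_limsup`: `limsup h` is a cluster
  value of `h` at `+∞`, Mathlib `MapClusterPt.limsup`, hence the limit of `h` along an ultrafilter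
  `𝒰 ≤ atTop`; the `𝒰`-limit extended linearly from the `𝒰`-convergent functions to all of `ℝ → ℝ`
  is a generalized limit, exactly as in the tree's `GeneralizedLimit.nonempty_holds`);
* a time-average measure `μ` of `U` for `Λ` (`exists_isTimeAverageMeasure_of_memLp`: the tree's
  `exists_timeAverageMeasure_holds`, FMRT Prop. 3.1, re-run for a steady force in `L²` rather than in
  `H` — its ingredients `Torus.IsGlobalLerayHopf.exists_isCompact_abs_longTimeAvg_le` (tightness by
  Rellich) and `RieszRepresentation.exists_probabilityMeasure_of_isTightFunctional` only use
  `f ∈ L²`);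
* `μ` is a stationary statistical solution of NS_ν(f) (FMRT Thm. 3.1; the tree's three proved
  conjuncts `Torus.IsTimeAverageMeasure.lintegral_eGradNormSq_lt_top`,
  `…integrable_generator_and_integral_eq_zero`, `…energy_ineq_shell`, all typed for an `L²` force);
* the observable `|v|²` agrees on the closed carrying set `{|v|² ≤ ρ} ∋ U t` with the bounded
  continuous `min(|v|², ρ)`, so it is `μ`-integrable and `∫ |v|² dμ = Λ h = limsup h = meanEnergy u`
  (`Torus.IsTimeAverageMeasure.integral_eq_of_eqOn`, FMRT Cor. 3.1, and
  `Torus.integral_norm_sq_eq_norm_lift_sq`); the ceiling hypothesis gives `≤ E`.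

The argument is packaged as `meanEnergy_le_of_ensembleCeiling` for any steady force `f ∈ L²` and
any lifted Leray–Hopf path (no ball hypothesis: every such lift lies in a ball of `H`,
`Torus.IsGlobalLerayHopf.exists_forall_lift_mem_closedBall`), of which the route declaration is a
specialisation; the hypotheses `IsDivFree f`, `HasZeroMean f` and the ball bound of the item are not
needed (the force enters the time-average theory only through `f ∈ L²`). The same lemma serves the
repaired bridge `FrustratedForces.EnsembleCeilingBridgeZ` (stmt-AnomalousDissipation-10437) once an
`H`-lift of a Leray–Hopf path from a mean-zero datum is produced.

## References

* C. Foias, O. Manley, R. Rosa, R. Temam, *Navier–Stokes Equations and Turbulence* (CUP 2001),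
  Ch. IV §1.3 Def. 1.4 (generalized limits, App. A.2), §3.1 Def. 3.1, Prop. 3.1, Cor. 3.1, Thm. 3.1.
  [FoiasManleyRosaTemam2001]
* C. R. Doering, C. Foias, J. Fluid Mech. 467 (2002), §2 (`Lim` attaining a prescribed `limsup`).
  [DoeringFoias2002]
-/

noncomputable section

open MeasureTheory Set Filter Topology
open scoped ENNReal NNReal BoundedContinuousFunction

namespace Summit.AnomalousDissipation.AnomalousDissipation.Theorems

open Literature.Analysis.FluidPDE Literature.Analysis.FunctionSpaces

-- the mandated namespace `Summit.<Summit>.<Problem>.Theorems` repeats `AnomalousDissipation` (single-problem summit)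
set_option linter.dupNamespace false

/-! ### Generalized limits attaining a prescribed `limsup` -/

/-- **Generalized limits from an ultrafilter at `+∞`.** For every ultrafilter `𝒰` on `ℝ` finer than
`atTop` there is a generalized (Banach) limit `Λ` with `Λ g = lim_𝒰 g` for every function `g`
converging along `𝒰`: the `𝒰`-limit is linear on the submodule of `𝒰`-convergent functions
(`GeneralizedLimit.limAlong`), any linear extension to `ℝ → ℝ` (`LinearMap.exists_extend`) will do,
and on eventually bounded `g` the `𝒰`-limit is a cluster value of `g` at `+∞`, hence lies in
`[liminf g, limsup g]` (Mathlib `MapClusterPt.liminf_le`, `MapClusterPt.le_limsup`). This is the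
construction of the tree's `GeneralizedLimit.nonempty_holds` (FMRT 2001, Ch. IV §1.3 Def. 1.4 and
App. A.2) with the ultrafilter as a parameter. -/
theorem exists_generalizedLimit_of_ultrafilter (𝒰 : Ultrafilter ℝ) (h𝒰 : (↑𝒰 : Filter ℝ) ≤ atTop) :
    ∃ Λ : GeneralizedLimit, ∀ (g : ℝ → ℝ) (c : ℝ), Tendsto g (↑𝒰 : Filter ℝ) (𝓝 c) → Λ g = c := by
  classical
  obtain ⟨Λ, hΛ⟩ := LinearMap.exists_extend (GeneralizedLimit.limAlong (↑𝒰 : Filter ℝ))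
  -- `Λ` returns the `𝒰`-limit of every `𝒰`-convergent function
  have hext : ∀ (g : ℝ → ℝ) (c : ℝ), Tendsto g (↑𝒰 : Filter ℝ) (𝓝 c) → Λ g = c := by
    intro g c hcT
    have hΛg := LinearMap.congr_fun hΛ ⟨g, ⟨c, hcT⟩⟩
    rw [LinearMap.comp_apply, Submodule.subtype_apply] at hΛg
    exact hΛg.trans (GeneralizedLimit.limAlong_eq_of_tendsto _ hcT)
  -- every eventually bounded function converges along `𝒰` to a cluster value at `+∞`
  have key : ∀ g : ℝ → ℝ, IsBoundedUnder (· ≤ ·) atTop g → IsBoundedUnder (· ≥ ·) atTop g →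
      ∃ c, liminf g atTop ≤ c ∧ c ≤ limsup g atTop ∧ Λ g = c := by
    intro g h₁ h₂
    obtain ⟨b, hb⟩ := id h₁
    obtain ⟨a, ha⟩ := id h₂
    have hb' : ∀ᶠ t in atTop, g t ≤ b := hb
    have ha' : ∀ᶠ t in atTop, a ≤ g t := ha
    have hmem : ∀ᶠ t in (↑𝒰 : Filter ℝ), g t ∈ Set.Icc a b :=
      (by filter_upwards [ha', hb'] with t hta htb using ⟨hta, htb⟩ :
        ∀ᶠ t in atTop, g t ∈ Set.Icc a b).filter_mono h𝒰
    obtain ⟨c, -, hc⟩ := isCompact_Icc.ultrafilter_le_nhds' (𝒰.map g) (mem_map.1 hmem)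
    have hcT : Tendsto g (↑𝒰 : Filter ℝ) (𝓝 c) := hc
    have hcl : MapClusterPt c atTop g := mapClusterPt_iff_ultrafilter.2 ⟨𝒰, h𝒰, hcT⟩
    exact ⟨c, hcl.liminf_le h₂, hcl.le_limsup h₁, hext g c hcT⟩
  refine ⟨⟨Λ, fun g h₁ h₂ => ?_, fun g h₁ h₂ => ?_⟩, fun g c hcT => hext g c hcT⟩
  · obtain ⟨c, hc₁, -, hc₃⟩ := key g h₁ h₂
    rw [hc₃]
    exact hc₁
  · obtain ⟨c, -, hc₂, hc₃⟩ := key g h₁ h₂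
    rw [hc₃]
    exact hc₂

/-- **A generalized limit attaining the `limsup` of one given function** (Doering–Foias 2002, §2:
"`Lim` may be chosen so that `Lim h = limsup h`"; FMRT 2001, Ch. IV §1.3). For `h : ℝ → ℝ`
eventually bounded above and below at `+∞` there is a generalized limit `Λ` with
`Λ h = limsup_{t → ∞} h t`: `limsup h` is a cluster value of `h` along `atTop`
(Mathlib `MapClusterPt.limsup`), i.e. the limit of `h` along some ultrafilter finer than `atTop`
(`mapClusterPt_iff_ultrafilter`), and `exists_generalizedLimit_of_ultrafilter` applies. -/
theorem exists_generalizedLimit_apply_eq_limsup {h : ℝ → ℝ}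
    (hb₁ : IsBoundedUnder (· ≤ ·) atTop h) (hb₂ : IsBoundedUnder (· ≥ ·) atTop h) :
    ∃ Λ : GeneralizedLimit, Λ h = limsup h atTop := by
  have hcl : MapClusterPt (limsup h atTop) atTop h :=
    MapClusterPt.limsup hb₂.isCoboundedUnder_le hb₁
  obtain ⟨𝒰, h𝒰, hT⟩ := mapClusterPt_iff_ultrafilter.1 hcl
  obtain ⟨Λ, hΛ⟩ := exists_generalizedLimit_of_ultrafilter 𝒰 h𝒰
  exact ⟨Λ, hΛ h _ hT⟩

/-! ### Time-average measures for a steady force in `L²` -/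

/-- **Existence of time-average measures, steady `L²` force** (FMRT 2001, Ch. IV §3.1 Def. 3.1,
Prop. 3.1). The tree's `exists_timeAverageMeasure_holds` is typed for a force `f ∈ H`; its proof
uses the force only through `f ∈ L²` (the a priori enstrophy bound behind the tightness lemma
`Torus.IsGlobalLerayHopf.exists_isCompact_abs_longTimeAvg_le`), and is repeated here verbatim for a
global Leray–Hopf solution on `T³` with viscosity `ν > 0` and any steady force `F ∈ L²(T³)`: for
every generalized limit `Λ` there is a Borel probability measure `μ` on `H` with
`∫ Ψ dμ = Lim_{T → ∞} T⁻¹ ∫₀ᵀ Ψ(U t) dt` for all bounded continuous `Ψ : H → ℝ` (Riesz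
representation of the tight positive normalised functional `Ψ ↦ Lim T⁻¹ ∫₀ᵀ Ψ(U t) dt` on the
Polish space `H`). -/
theorem exists_isTimeAverageMeasure_of_memLp {ν : ℝ} (hν : 0 < ν)
    {F u₀ : UnitAddTorus (Fin 3) → EuclideanSpace ℝ (Fin 3)} (hF : MemLp F 2 volume)
    {u : ℝ → UnitAddTorus (Fin 3) → EuclideanSpace ℝ (Fin 3)}
    (hu : Torus.IsGlobalLerayHopf ν (fun _ => F) u₀ u)
    {U : ℝ → Torus.energySpace (Fin 3)}
    (hU : ∀ t, 0 ≤ t →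
      (((U t : Lp (EuclideanSpace ℝ (Fin 3)) 2 (volume : Measure (UnitAddTorus (Fin 3)))) :
        UnitAddTorus (Fin 3) → EuclideanSpace ℝ (Fin 3))) =ᵐ[volume] u t)
    (Λ : GeneralizedLimit) :
    ∃ μ : Measure (Torus.energySpace (Fin 3)), Torus.IsTimeAverageMeasure Λ.longTimeAvg U μ := by
  classical
  haveI : Fact ((2 : ℝ≥0∞) ≠ ∞) := ⟨ENNReal.ofNat_ne_top⟩
  haveI : SecondCountableTopology
      (Lp (EuclideanSpace ℝ (Fin 3)) 2 (volume : Measure (UnitAddTorus (Fin 3)))) :=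
    inferInstance
  haveI : SecondCountableTopology (Torus.energySpace (Fin 3)) :=
    TopologicalSpace.Subtype.secondCountableTopology _
  haveI : PolishSpace (Torus.energySpace (Fin 3)) := inferInstance
  -- measurability of the lift and the functional
  have hUm : AEStronglyMeasurable U (volume.restrict (Ioi 0)) :=
    Torus.IsGlobalLerayHopf.aestronglyMeasurable_lift hu hU
  obtain ⟨L, hL⟩ := Torus.exists_linearMap_longTimeAvg Λ hUm
  have hpos : ∀ g : Torus.energySpace (Fin 3) →ᵇ ℝ, (∀ x, 0 ≤ g x) → 0 ≤ L g := by
    intro g hg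
    rw [hL]
    exact Λ.longTimeAvg_nonneg (fun t => hg (U t)) (C := ‖g‖) fun t _ => by
      rw [← Real.norm_eq_abs]
      exact g.norm_coe_le_norm (U t)
  have hone : L 1 = 1 := by
    rw [hL]
    exact Λ.longTimeAvg_one
  have htight : Literature.MeasureTheory.RieszRepresentation.IsTightFunctional L := by
    intro ε hε
    obtain ⟨K, hK, hKε⟩ :=
      Torus.IsGlobalLerayHopf.exists_isCompact_abs_longTimeAvg_le hν hF hu hU Λ hε
    exact ⟨K, hK, fun g hg => by rw [hL]; exact hKε g hg⟩
  obtain ⟨μ, hμ, hint⟩ :=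
    Literature.MeasureTheory.RieszRepresentation.exists_probabilityMeasure_of_isTightFunctional L hpos
      htight hone
  refine ⟨μ, hμ, fun Ψ hΨc hΨb => ?_⟩
  obtain ⟨C, hC⟩ := hΨb.exists_norm_le
  set g : Torus.energySpace (Fin 3) →ᵇ ℝ :=
    BoundedContinuousFunction.ofNormedAddCommGroup Ψ hΨc C fun x => hC _ ⟨x, rfl⟩ with hg
  have h := hint g
  rw [hL] at h
  simpa only [hg, BoundedContinuousFunction.coe_ofNormedAddCommGroup] using h

/-! ### The transfer for a steady `L²` force -/

/-- **Ensemble ceilings reach every lifted Leray–Hopf path** (FMRT 2001, Ch. IV §3.1 Prop. 3.1,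
Cor. 3.1, Thm. 3.1; Doering–Foias 2002, §2). Let `ν > 0`, `f ∈ L²(T³)` a steady force, and suppose
every stationary statistical solution `μ` of NS_ν(f) with integrable energy has `∫ |v|² dμ ≤ E`.
Then every global Leray–Hopf solution `u` (any datum `u₀`) admitting an `H`-lift `U` of its slices
(`U t = u t` a.e. for every `t ≥ 0`) has `meanEnergy u = limsup_T T⁻¹ ∫₀ᵀ |u(t)|² dt ≤ E`. No ball
hypothesis is needed: the lift of a Leray–Hopf path with steady `L²` force stays in a ball of `H`
(`Torus.IsGlobalLerayHopf.exists_forall_lift_mem_closedBall`). Choose a generalized limit `Λ`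
attaining the `limsup` of the Cesàro means of `t ↦ |U t|²` (`exists_generalizedLimit_apply_eq_limsup`),
a time-average measure `μ` of `U` for `Λ` (`exists_isTimeAverageMeasure_of_memLp`), which is a
stationary statistical solution (tree lemmas behind `timeAverage_isStationary_holds`), and evaluate
the ceiling on the observable `|v|²`: it agrees with the bounded continuous `min(|v|², ρ)` on the
closed carrying set `{|v|² ≤ ρ}`, so it is `μ`-integrable with
`∫ |v|² dμ = Λ(T ↦ T⁻¹∫₀ᵀ|U t|²) = meanEnergy u` (`Torus.IsTimeAverageMeasure.integral_eq_of_eqOn`,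
`Torus.integral_norm_sq_eq_norm_lift_sq`). -/
theorem meanEnergy_le_of_ensembleCeiling {ν E : ℝ} (hν : 0 < ν)
    {f u₀ : UnitAddTorus (Fin 3) → EuclideanSpace ℝ (Fin 3)} (hF : MemLp f 2 volume)
    (hceil : ∀ μ : Measure (Torus.energySpace (Fin 3)),
      Torus.IsStationaryStatisticalSolution ν f μ →
        Integrable (fun v : Torus.energySpace (Fin 3) => ‖v‖ ^ 2) μ → Torus.ensembleEnergy μ ≤ E)
    {u : ℝ → UnitAddTorus (Fin 3) → EuclideanSpace ℝ (Fin 3)}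
    (hu : Torus.IsGlobalLerayHopf ν (fun _ => f) u₀ u)
    {U : ℝ → Torus.energySpace (Fin 3)}
    (hU : ∀ t, 0 ≤ t →
      (((U t : Lp (EuclideanSpace ℝ (Fin 3)) 2 (volume : Measure (UnitAddTorus (Fin 3)))) :
        UnitAddTorus (Fin 3) → EuclideanSpace ℝ (Fin 3))) =ᵐ[volume] u t) :
    meanEnergy u ≤ E := by
  -- the carrying ball `|U t|² ≤ ρ`, `t ≥ 0`
  obtain ⟨ρ, hρ0, hρ⟩ := hu.exists_forall_lift_mem_closedBall hν hF hU
  have hball : ∀ t, 0 ≤ t → ‖U t‖ ^ 2 ≤ ρ := fun t ht => (hρ t ht).1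
  -- the Cesàro means of the energy along the lift are eventually bounded
  have hgabs : ∀ t, 0 < t → |(fun s => ‖U s‖ ^ 2) t| ≤ ρ := fun t ht => by
    rw [abs_of_nonneg (sq_nonneg _)]
    exact hball t ht.le
  have hb₁ : IsBoundedUnder (· ≤ ·) atTop (timeMean fun s => ‖U s‖ ^ 2) :=
    isBoundedUnder_le_timeMean hgabs
  have hb₂ : IsBoundedUnder (· ≥ ·) atTop (timeMean fun s => ‖U s‖ ^ 2) :=
    isBoundedUnder_ge_timeMean hgabs
  -- a generalized limit attaining the limsup of these Cesàro means
  obtain ⟨Λ, hΛ⟩ := exists_generalizedLimit_apply_eq_limsup hb₁ hb₂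
  -- a time-average measure of `U` for `Λ`; it is a stationary statistical solution of NS_ν(f)
  obtain ⟨μ, hμ⟩ := exists_isTimeAverageMeasure_of_memLp hν hF hu hU Λ
  have hstat : Torus.IsStationaryStatisticalSolution ν f μ :=
    ⟨hμ.1, Torus.IsTimeAverageMeasure.lintegral_eGradNormSq_lt_top hν hF hu hU hμ,
      fun Φ => Torus.IsTimeAverageMeasure.integrable_generator_and_integral_eq_zero hν hF hu hU hμ Φ,
      fun e₁ e₂ he => Torus.IsTimeAverageMeasure.energy_ineq_shell hν hF hu hU hμ e₁ e₂ he⟩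
  -- the energy observable agrees with `min(|v|², ρ)` on the closed carrying set `{|v|² ≤ ρ}`
  have hKc : IsClosed {v : Torus.energySpace (Fin 3) | ‖v‖ ^ 2 ≤ ρ} :=
    isClosed_le (continuous_norm.pow 2) continuous_const
  have hUK : ∀ t, 0 ≤ t → U t ∈ {v : Torus.energySpace (Fin 3) | ‖v‖ ^ 2 ≤ ρ} :=
    fun t ht => hball t ht
  have hΨc : Continuous fun v : Torus.energySpace (Fin 3) => min (‖v‖ ^ 2) ρ :=
    (continuous_norm.pow 2).min continuous_const
  have hΨb : ∀ v : Torus.energySpace (Fin 3), |min (‖v‖ ^ 2) ρ| ≤ ρ := fun v => by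
    rw [abs_of_nonneg (le_min (sq_nonneg _) hρ0)]
    exact min_le_right _ _
  have heq : EqOn (fun v : Torus.energySpace (Fin 3) => ‖v‖ ^ 2)
      (fun v => min (‖v‖ ^ 2) ρ) {v | ‖v‖ ^ 2 ≤ ρ} := fun v hv => (min_eq_left hv).symm
  obtain ⟨hint, hI⟩ := hμ.integral_eq_of_eqOn hKc hUK hΨc hΨb heq
  -- the ceiling, evaluated at `μ`
  have hE : Torus.ensembleEnergy μ ≤ E := hceil μ hstat hint
  -- `meanEnergy u = limsup of the Cesàro means = Λ (Cesàro means) = ∫ |v|² dμ`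
  have h1 : Torus.ensembleEnergy μ = Λ (timeMean fun s => ‖U s‖ ^ 2) := hI
  have h2 : meanEnergy u = limsup (timeMean fun s => ‖U s‖ ^ 2) atTop := by
    rw [meanEnergy_eq_longTimeAvgSup]
    unfold longTimeAvgSup
    refine limsup_congr (timeMean_eventuallyEq fun t ht => ?_)
    rw [Torus.integral_norm_sq_eq_norm_lift_sq hU ht.le, Submodule.coe_norm]
  rw [h2, ← hΛ, ← h1]
  exact hE

/-! ### The route declaration -/

/-- **`EnsembleCeilingTransfer` (route TaylorCertificates, item stmt-AnomalousDissipation-14092).**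
For `ν > 0`, a smooth (divergence-free, mean-zero) force `f` on `T³`, a ceiling `∫ |v|² dμ ≤ E` over
all stationary statistical solutions `μ` of NS_ν(f) with integrable energy, a global Leray–Hopf
solution `u` (datum `u₀`) and an `H`-lift `U` of its slices (`U t = u t` a.e., `t ≥ 0`) staying in
the ball `|U t|² ≤ ρ`: `meanEnergy u ≤ E`. Immediate from `meanEnergy_le_of_ensembleCeiling` with
`f ∈ L²` (`Torus.IsSmooth.memLp`); the hypotheses `IsDivFree f`, `HasZeroMean f` and the ball bound
are not used (the force enters the time-average theory only through `f ∈ L²`, and every lifted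
Leray–Hopf path lies in a ball of `H`). -/
theorem EnsembleCeilingTransfer_proof :
    Summit.AnomalousDissipation.AnomalousDissipation.Theses.TaylorCertificates.EnsembleCeilingTransfer := by
  intro ν E ρ f u₀ u U hν hfs _hfd _hfz hceil hu hU _hball
  exact meanEnergy_le_of_ensembleCeiling hν (hfs.memLp 2) hceil hu hU

end Summit.AnomalousDissipation.AnomalousDissipation.Theorems

end
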